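import Summits.CriticalPhenomena.SAWScalingLimit.Theorems.SAWDefectDecoherenceObservableToSLERNestedTransferP
import HarnessLib

/-!
# The nested transfer with the locality scale bounded (stub T6 `stub_nestedTransferPR`, reshape r3 of the
# line `six-class-type-ladder`; crux `SAWDevelopingMap.ObservableToSLE`, stmt-CriticalPhenomena-10472)

Landing target:
`Summits/CriticalPhenomena/SAWScalingLimit/Theorems/SAWDevelopingMapObservableToSLETypeLadderNestedTransferPR.lean`
(`--supports stmt-CriticalPhenomena-10472`; continuation lead prover-line-stmt-CriticalPhenomena-10472-c3-0).

Why: the abundance hypothesis of the landed predicate-parametric nested transfer `stub_nestedTransferP`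
(twin line, p117872; `…ObservableToSLERNestedTransferP.lean`) quantifies the locality scale universally
(`∀ ε > 0, ∀ R > 0, ∃ ρ N, …`) and is therefore UNSATISFIABLE — a good gate carries a `ρ/4`-wide escape to
distance `2R` inside the bounded domain (`TypeLadder.stub_not_nestedRenewalP`, p124536).  The transfer itself
only ever applies abundance at one small scale `R := min (min R₀ R₁) (η/(2(3K+1)))`, so it survives for the
re-typed input `NestedRenewalPR P` (`∀ ε > 0, ∃ R₂ > 0, ∀ R ∈ Ioc 0 R₂, ∃ ρ N, …`) with one more `min`.  This
file is that port, verbatim otherwise (the original's vocabulary `productCellN`,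
`abs_integral_sub_le_of_productCellN_link`, `eventually_productCellN`, `ext_of_forall_lipschitz_integral_eq` is
opened from `…ObservableToSLER.NestedGate` / `…BridgeGate`):

* `fullIdentification_of_productCellN_PR` — the soft assembly with bounded locality scale;
* `stub_nestedTransferPR` — the registered stub T6 of skeleton r3 (signature verbatim).
-/

noncomputable section

open scoped BigOperators Topology NNReal ENNReal Classical BoundedContinuousFunction
open Filter Set MeasureTheory Metric
open Literature.Probability.LatticeModels (HexVertex hexGraph hexCenter triZeta Site)
open Literature.Probability.RandomPlanarGeometry
open Literature.Probability.RandomPlanarGeometry.SAW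

namespace Summit.CriticalPhenomena.SAWScalingLimit.Theorems.ObservableToSLE.TypeLadder

open Summit.CriticalPhenomena.SAWScalingLimit.Theorems.ObservableToSLER.BridgeGate
open Summit.CriticalPhenomena.SAWScalingLimit.Theorems.ObservableToSLER.NestedGate
open Summit.CriticalPhenomena.SAWScalingLimit.Theorems.ObservableToSLE.Negative
  (eventually_isProbabilityMeasure_hexSAWLaw)

section Final

/-- **Full identification from the product-cell structure, abundance with the LOCALITY SCALE BOUNDED**
(port of `fullIdentification_of_productCellN_P`, p117872, whose abundance hypothesis `∀ R > 0` is
unsatisfiable — `TypeLadder.stub_not_nestedRenewalP`, p124536): the abundance input is only asked for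
`R ∈ (0, R₂(D, a, b, ε)]`, and the proof takes `R := min (min (min R₀ R₁) R₂) (η / (2 (3K + 1)))`; otherwise
verbatim. [cite: DuminilCopinSmirnov2012, §4 (the critical hexagonal SAW law); soft assembly, folklore] -/
theorem fullIdentification_of_productCellN_PR
    (P : DobrushinDomain → (ℝ → HexVertex) → (ℝ → HexVertex) → ℝ → ℝ → ℝ → ℕ →
      (ℕ → Set HexVertex) → (ℕ → Set HexVertex) → Prop)
    (hGD : ∀ (Ω : Set ℂ) (δ : ℝ) (a b p q p' q' : HexVertex) (S T : Set HexVertex)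
       (l₁ l₂ : List HexVertex) (B : Set (List HexVertex)),
       Disjoint S T →
       (∃ w₁ : (hexDomainGraph Ω δ).Walk a p, w₁.IsPath ∧ w₁.support = l₁ ∧ ∀ v ∈ l₁, v ∈ S) →
       (∃ w₂ : (hexDomainGraph Ω δ).Walk p' b, w₂.IsPath ∧ w₂.support = l₂ ∧ ∀ v ∈ l₂, v ∈ T) →
       (hexDomainGraph Ω δ).Adj p q → (hexDomainGraph Ω δ).Adj q' p' →
       hexSAWWeight Ω δ a b
           {γ | ∃ mid ∈ B, mid.head? = some q ∧ mid.getLast? = some q' ∧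
             (∀ v ∈ mid, v ∉ S ∧ v ∉ T) ∧ γ.walk.support = l₁ ++ mid ++ l₂} =
         ENNReal.ofReal (hexCriticalFugacity ^ (l₁.length + l₂.length)) *
           hexSAWWeight Ω δ q q'
             {γ | γ.walk.support ∈ B ∧ ∀ v ∈ γ.walk.support, v ∉ S ∧ v ∉ T})
    (hNR : ∀ (D : DobrushinDomain) (a b : ℝ → HexVertex), IsEmbEndpointApprox hexGraph hexCenter D a b →
       ∀ ε > (0 : ℝ), ∃ R₂ > (0 : ℝ), ∀ R ∈ Set.Ioc (0 : ℝ) R₂, ∃ ρ > (0 : ℝ), ∃ N : ℕ,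
         ∀ᶠ δ : ℝ in 𝓝[>] 0,
         ∃ S T : ℕ → Set HexVertex,
           TameNestedFamily δ R N (a δ) S ∧ TameNestedFamily δ R N (b δ) T ∧
           P D a b δ ρ R N S T ∧
           hexSAWLaw D.carrier δ (a δ) (b δ)
               {γ | ¬ ∃ (n m : ℕ) (p q : HexVertex) (n' m' : ℕ) (p' q' : HexVertex),
                   IsFirstGoodGateN D.carrier δ ρ R S (a δ) γ.walk.support n m p q ∧
                   IsFirstGoodGateN D.carrier δ ρ R T (b δ) γ.walk.support.reverse n' m' p' q' ∧
                   WideLink D.carrier δ ρ (S n ∪ T n') q q'} ≤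
             ENNReal.ofReal ε)
    (hCN : ∀ (D : DobrushinDomain) (a b : ℝ → HexVertex), IsEmbEndpointApprox hexGraph hexCenter D a b →
       ∀ (ν : Measure (CurveClass ℂ)), IsSLELaw ((8 : ℝ≥0) / 3) D ν →
       ∀ (f : CurveClass ℂ →ᵇ ℝ) (ε : ℝ), 0 < ε →
         ∃ R₀ > (0 : ℝ), ∀ R ∈ Set.Ioc (0 : ℝ) R₀, ∀ ρ > (0 : ℝ), ∀ N : ℕ,
           ∀ᶠ δ : ℝ in 𝓝[>] 0, ∀ S T : ℕ → Set HexVertex,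
             TameNestedFamily δ R N (a δ) S → TameNestedFamily δ R N (b δ) T →
             P D a b δ ρ R N S T →
             hexSAWLaw D.carrier δ (a δ) (b δ)
               {γ | ∃ (n m : ℕ) (p q : HexVertex) (n' m' : ℕ) (p' q' : HexVertex),
                   IsFirstGoodGateN D.carrier δ ρ R S (a δ) γ.walk.support n m p q ∧
                   IsFirstGoodGateN D.carrier δ ρ R T (b δ) γ.walk.support.reverse n' m' p' q' ∧
                   WideLink D.carrier δ ρ (S n ∪ T n') q q' ∧
                   ε < |(∫ ξ, f ξ.curve ∂(carvedLaw D.carrier δ (S n ∪ T n') q q')) - ∫ x, f x ∂ν|} ≤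
               ENNReal.ofReal ε)
    (hcells : ∀ (D : DobrushinDomain) (a b : ℝ → HexVertex), IsEmbEndpointApprox hexGraph hexCenter D a b →
       ∃ R₁ > (0 : ℝ), ∀ R ∈ Set.Ioc (0 : ℝ) R₁, ∀ (ρ : ℝ) (N : ℕ), ∀ᶠ δ : ℝ in 𝓝[>] 0,
         ∀ S T : ℕ → Set HexVertex, TameNestedFamily δ R N (a δ) S →
           TameNestedFamily δ R N (b δ) T →
           ∀ γ₀ : HexDomainSAW D.carrier δ (a δ) (b δ),
             γ₀ ∈ productCellN D.carrier δ ρ R S T (a δ) (b δ) (3 * R))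
    (D : DobrushinDomain) (a b : ℝ → HexVertex) (hab : IsEmbEndpointApprox hexGraph hexCenter D a b)
    (μ : Measure (CurveClass ℂ)) (hμ : IsProbabilityMeasure μ)
    (hsub : IsSubseqLimitLaw (fun δ (γ : HexDomainSAW D.carrier δ (a δ) (b δ)) => γ.curve)
      (fun δ => hexSAWLaw D.carrier δ (a δ) (b δ)) μ) :
    IsSLELaw ((8 : ℝ≥0) / 3) D μ := by
  obtain ⟨ν, hν⟩ := exists_isSLELaw_of_ne_eight (κ := (8 : ℝ≥0) / 3) (by positivity) (by norm_num) D
  obtain ⟨Γ, hΓ, rfl⟩ := hν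
  haveI := isProbabilityMeasure_preWienerMeasure'
  haveI : IsProbabilityMeasure (Literature.Probability.Process.preWienerMeasure.map Γ) :=
    Measure.isProbabilityMeasure_map hΓ.1
  suffices hμν : μ = Literature.Probability.Process.preWienerMeasure.map Γ from ⟨Γ, hΓ, hμν⟩
  set ν := Literature.Probability.Process.preWienerMeasure.map Γ with hνdef
  have hνlaw : IsSLELaw ((8 : ℝ≥0) / 3) D ν := ⟨Γ, hΓ, rfl⟩
  obtain ⟨s, hs, hlim⟩ := hsub
  refine ext_of_forall_lipschitz_integral_eq fun f K hf => ?_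
  -- `|∫ f dμ - ∫ f dν| ≤ η` for every `η > 0`
  have key : ∀ η : ℝ, 0 < η → |∫ x, f x ∂μ - ∫ x, f x ∂ν| ≤ η := by
    intro η hη
    set ε : ℝ := η / (4 * (1 + 4 * ‖f‖)) with hε
    have hε0 : 0 < ε := by positivity
    obtain ⟨R₀, hR₀, hCN'⟩ := hCN D a b hab ν hνlaw f ε hε0
    obtain ⟨R₁, hR₁, hcells'⟩ := hcells D a b hab
    obtain ⟨R₂, hR₂, hNR₂⟩ := hNR D a b hab ε hε0
    set R : ℝ := min (min (min R₀ R₁) R₂) (η / (2 * (3 * K + 1))) with hR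
    have hRpos : 0 < R := by positivity
    have hRR₀ : R ≤ R₀ := ((min_le_left _ _).trans (min_le_left _ _)).trans (min_le_left _ _)
    have hRR₁ : R ≤ R₁ := ((min_le_left _ _).trans (min_le_left _ _)).trans (min_le_right _ _)
    have hRR₂ : R ≤ R₂ := (min_le_left _ _).trans (min_le_right _ _)
    have hK : (0 : ℝ) ≤ K := K.2
    have hRη : (K : ℝ) * (3 * R) ≤ η / 2 := by
      have h1 : R ≤ η / (2 * (3 * K + 1)) := min_le_right _ _
      calc (K : ℝ) * (3 * R) = 3 * K * R := by ring
        _ ≤ (3 * K + 1) * R := by nlinarith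
        _ ≤ (3 * K + 1) * (η / (2 * (3 * K + 1))) := mul_le_mul_of_nonneg_left h1 (by positivity)
        _ = η / 2 := by field_simp
    have hεη : 2 * ε * (1 + 4 * ‖f‖) = η / 2 := by
      rw [hε]; field_simp; ring
    obtain ⟨ρ, hρ, N, hNR'⟩ := hNR₂ R ⟨hRpos, hRR₂⟩
    have hCN'' := hCN' R ⟨hRpos, hRR₀⟩ ρ hρ N
    have hcells'' := hcells' R ⟨hRpos, hRR₁⟩ ρ N
    have hprob := eventually_isProbabilityMeasure_hexSAWLaw hab
    have hev : ∀ᶠ δ : ℝ in 𝓝[>] 0,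
        |∫ γ, f γ.curve ∂(hexSAWLaw D.carrier δ (a δ) (b δ)) - ∫ x, f x ∂ν| ≤ η := by
      filter_upwards [hNR', hCN'', hcells'', hprob, self_mem_nhdsWithin] with δ h1 h2 h3 h4 hδ
      haveI := h4
      obtain ⟨S, T, hS, hT, hP, h1⟩ := h1
      have hest := abs_integral_sub_le_of_productCellN_link (ρ := ρ) (R := R) (S := S) (T := T)
        D.isBounded hδ (by positivity : (0 : ℝ) ≤ 3 * R) (hGD D.carrier δ (a δ) (b δ))
        (h3 S T hS hT) ν f hf hε0.le (ENNReal.toReal_le_of_le_ofReal hε0.le h1)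
        (ENNReal.toReal_le_of_le_ofReal hε0.le (h2 S T hS hT hP))
      calc _ ≤ K * (3 * R) + 2 * ε * (1 + 4 * ‖f‖) := hest
        _ ≤ η / 2 + η / 2 := add_le_add hRη hεη.le
        _ = η := by ring
    have hev' : ∀ᶠ n in atTop, |∫ γ, f γ.curve ∂(hexSAWLaw D.carrier (s n) (a (s n)) (b (s n))) -
        ∫ x, f x ∂ν| ≤ η := hs.eventually hev
    have hcont : Tendsto (fun n => |∫ γ, f γ.curve ∂(hexSAWLaw D.carrier (s n) (a (s n)) (b (s n))) -
        ∫ x, f x ∂ν|) atTop (𝓝 |∫ x, f x ∂μ - ∫ x, f x ∂ν|) :=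
      ((hlim f).sub tendsto_const_nhds).abs
    exact le_of_tendsto hcont hev'
  have h0 : |∫ x, f x ∂μ - ∫ x, f x ∂ν| ≤ 0 :=
    le_of_forall_pos_le_add fun η hη => by rw [zero_add]; exact key η hη
  exact sub_eq_zero.1 (abs_eq_zero.1 (le_antisymm h0 (abs_nonneg _)))

end Final

/-- **Registered stub T6 `stub_nestedTransferPR` of the line `six-class-type-ladder` (crux item
stmt-CriticalPhenomena-10472, skeleton r3) — THE NESTED TRANSFER WITH THE LOCALITY SCALE BOUNDED**:
`∀ P, GateDecomposition → NestedRenewalPR P → CarvedToSLENP P → FullIdentification`, where the abundance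
input `NestedRenewalPR P` asks for widely linked first good gates in some `P`-constrained tame nested
families with probability `≥ 1 − ε` only for locality scales `R ≤ R₂(D, a, b, ε)`.  Proof: the eventual
product structure of the cells (`eventually_productCellN`, landed) feeds `fullIdentification_of_productCellN_PR`. -/
theorem stub_nestedTransferPR :
    ∀ (P : DobrushinDomain → (ℝ → HexVertex) → (ℝ → HexVertex) → ℝ → ℝ → ℝ → ℕ →
      (ℕ → Set HexVertex) → (ℕ → Set HexVertex) → Prop),
    (∀ (Ω : Set ℂ) (δ : ℝ) (a b p q p' q' : HexVertex) (S T : Set HexVertex) (l₁ l₂ : List HexVertex)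
       (B : Set (List HexVertex)),
       Disjoint S T →
       (∃ w₁ : (hexDomainGraph Ω δ).Walk a p, w₁.IsPath ∧ w₁.support = l₁ ∧ ∀ v ∈ l₁, v ∈ S) →
       (∃ w₂ : (hexDomainGraph Ω δ).Walk p' b, w₂.IsPath ∧ w₂.support = l₂ ∧ ∀ v ∈ l₂, v ∈ T) →
       (hexDomainGraph Ω δ).Adj p q → (hexDomainGraph Ω δ).Adj q' p' →
       hexSAWWeight Ω δ a b
           {γ | ∃ mid ∈ B, mid.head? = some q ∧ mid.getLast? = some q' ∧
             (∀ v ∈ mid, v ∉ S ∧ v ∉ T) ∧ γ.walk.support = l₁ ++ mid ++ l₂} =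
         ENNReal.ofReal (hexCriticalFugacity ^ (l₁.length + l₂.length)) *
           hexSAWWeight Ω δ q q'
             {γ | γ.walk.support ∈ B ∧ ∀ v ∈ γ.walk.support, v ∉ S ∧ v ∉ T}) →
    (∀ (D : DobrushinDomain) (a b : ℝ → HexVertex), IsEmbEndpointApprox hexGraph hexCenter D a b →
       ∀ ε > (0 : ℝ), ∃ R₂ > (0 : ℝ), ∀ R ∈ Set.Ioc (0 : ℝ) R₂, ∃ ρ > (0 : ℝ), ∃ N : ℕ, ∀ᶠ δ : ℝ in 𝓝[>] 0,
         ∃ S T : ℕ → Set HexVertex,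
           TameNestedFamily δ R N (a δ) S ∧ TameNestedFamily δ R N (b δ) T ∧
           P D a b δ ρ R N S T ∧
           hexSAWLaw D.carrier δ (a δ) (b δ)
               {γ | ¬ ∃ (n m : ℕ) (p q : HexVertex) (n' m' : ℕ) (p' q' : HexVertex),
                   IsFirstGoodGateN D.carrier δ ρ R S (a δ) γ.walk.support n m p q ∧
                   IsFirstGoodGateN D.carrier δ ρ R T (b δ) γ.walk.support.reverse n' m' p' q' ∧
                   WideLink D.carrier δ ρ (S n ∪ T n') q q'} ≤
             ENNReal.ofReal ε) →
    (∀ (D : DobrushinDomain) (a b : ℝ → HexVertex), IsEmbEndpointApprox hexGraph hexCenter D a b →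
       ∀ (ν : Measure (CurveClass ℂ)), IsSLELaw ((8 : ℝ≥0) / 3) D ν →
       ∀ (f : CurveClass ℂ →ᵇ ℝ) (ε : ℝ), 0 < ε →
         ∃ R₀ > (0 : ℝ), ∀ R ∈ Set.Ioc (0 : ℝ) R₀, ∀ ρ > (0 : ℝ), ∀ N : ℕ,
           ∀ᶠ δ : ℝ in 𝓝[>] 0, ∀ S T : ℕ → Set HexVertex,
             TameNestedFamily δ R N (a δ) S → TameNestedFamily δ R N (b δ) T →
             P D a b δ ρ R N S T →
             hexSAWLaw D.carrier δ (a δ) (b δ)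
               {γ | ∃ (n m : ℕ) (p q : HexVertex) (n' m' : ℕ) (p' q' : HexVertex),
                   IsFirstGoodGateN D.carrier δ ρ R S (a δ) γ.walk.support n m p q ∧
                   IsFirstGoodGateN D.carrier δ ρ R T (b δ) γ.walk.support.reverse n' m' p' q' ∧
                   WideLink D.carrier δ ρ (S n ∪ T n') q q' ∧
                   ε < |(∫ ξ, f ξ.curve ∂(carvedLaw D.carrier δ (S n ∪ T n') q q')) - ∫ x, f x ∂ν|} ≤
               ENNReal.ofReal ε) →
    ∀ (D : DobrushinDomain) (a b : ℝ → HexVertex),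
      IsEmbEndpointApprox hexGraph hexCenter D a b →
      ∀ μ : Measure (CurveClass ℂ), IsProbabilityMeasure μ →
        IsSubseqLimitLaw (fun δ (γ : HexDomainSAW D.carrier δ (a δ) (b δ)) => γ.curve)
          (fun δ => hexSAWLaw D.carrier δ (a δ) (b δ)) μ →
        IsSLELaw ((8 : ℝ≥0) / 3) D μ :=
  fun P hGD hNR hCN D a b hab μ hμ hsub =>
    fullIdentification_of_productCellN_PR P hGD hNR hCN
      (fun D a b hab => eventually_productCellN D a b hab) D a b hab μ hμ hsub

end Summit.CriticalPhenomena.SAWScalingLimit.Theorems.ObservableToSLE.TypeLadder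

end
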